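import Mathlib.Algebra.MvPolynomial.Basic
import Mathlib.Algebra.MvPolynomial.Eval
import Mathlib.Algebra.MvPolynomial.Rename
import Mathlib.Order.ConditionallyCompleteLattice.Basic
import Mathlib.Order.Lattice.Nat
import HarnessLib

-- provenance: harness21/H21/H21/Prelude/CplxAlg/ArithCircuit.lean @ 12e2ffd (interim HEAD d8f2665); M5 mechanical rewrite
/-!
# Arithmetic circuits (trunk CplxAlg, notion `arithmetic_circuit`, part 1)

Straight-line arithmetic circuits (topologically sorted DAGs with sharing) with unbounded fan-in
weighted-sum and product gates, over a commutative semiring `k` of coefficients and an arbitrary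
type `σ` of variables, together with their total semantics into `MvPolynomial σ k` and the derived
size measures `complexity`, `constantFreeComplexity`, `circuitSize`.

## Sources

* P. Bürgisser, *Completeness and Reduction in Algebraic Complexity Theory*, Springer 2000,
  Definition 2.1 (straight-line programs, total complexity `L_k`), §1.4 (constant-free model).
* L. Valiant, *Completeness classes in algebra*, STOC 1979.
* G. Malod, *Polynômes et coefficients*, PhD thesis 2003 (constant-free circuits).

## Design choices

* A circuit `ArithCircuit k σ` is a `List` of gates plus a designated output operand. Gate number
  `i` may reference variables `X j`, constants `c : k`, or an earlier gate by its *absolute* index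
  `j : ℕ`. A gate is a weighted sum `∑ cᵢ • uᵢ` or a product `∏ uᵢ` of a list of operands
  (empty sum `= 0`, empty product `= 1`). Size `=` number of gates, so every shared gate is counted
  exactly once.
* Semantics is a *total* left fold: a forward or out-of-range gate reference evaluates to the junk
  value `0`. Since `0` is also available as `Operand.const 0`, junk references never lower any of
  the complexity measures (`ArithCircuit.exists_wellFormed_of_computes`). The operation
  `Operand.truncate n` (junk references `gate j`, `n ≤ j`, become `const 0`) makes this explicit
  and is used in `ArithCircuit.add` / `ArithCircuit.mul` so that `eval_add` / `eval_mul` hold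
  unconditionally.
* `complexity f` is Bürgisser's total complexity `L_k(f)` only *up to a constant factor `≤ 3`*:
  a fan-in-two sum gate `c • u + d • v` is one gate here and up to three operations there. All
  target statements consuming `complexity` are invariant under constant factors.
* The constant-free model (`HasSignConstants`, `constantFreeComplexity`) restricts all constants and
  sum coefficients to `{0, 1, -1}`, spelled semiring-friendly as `c = 0 ∨ c = 1 ∨ c + 1 = 0`.
* Minimisation is `sInf` over `ℕ`; the junk value `sInf ∅ = 0` is documented on each measure.
* Deviation from the outline checklist: `complexity_rename_le` is stated *without* the
  injectivity hypothesis (the inequality `L(rename e f) ≤ L(f)` holds for every `e`); the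
  injective case is the equality `complexity_rename_of_injective`.
* Mathlib has no arithmetic-circuit / straight-line-program notion (searched: `ArithCircuit`,
  `straight-line`, `arithmetic circuit`); only `MvPolynomial` and `MvPolynomial.rename` are reused.

Everything lives in `namespace Literature.CplxAlg`, inside a `noncomputable section`.
-/

noncomputable section

open MvPolynomial

namespace Literature.Computability.AlgebraicComplexity

universe u v w u'

namespace ArithCircuit

/-- An operand of a gate of an arithmetic circuit over coefficients `k` and variables `σ`: an input
variable `var i` (denoting `X i`), a constant `const c` (denoting `C c`), or a reference `gate j` to
(the value of) gate number `j` (Bürgisser 2000, Def. 2.1). [cite: Burgisser2000, Def. 2.1] -/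
inductive Operand (k : Type u) (σ : Type v) : Type max u v
  /-- The input variable `X i`. -/
  | var (i : σ) : Operand k σ
  /-- The scalar constant `c`. -/
  | const (c : k) : Operand k σ
  /-- A reference to the value of gate number `j` (absolute index in the gate list). -/
  | gate (j : ℕ) : Operand k σ
  deriving DecidableEq

/-- A gate of an arithmetic circuit: a weighted sum `∑ c • u` over a list of (coefficient, operand)
pairs, or a product `∏ u` over a list of operands; unbounded fan-in (Bürgisser 2000, Def. 2.1;
unbounded fan-in as in Limaye–Srinivasan–Tavenas 2021). [cite: Burgisser2000, Def. 2.1] -/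
inductive Gate (k : Type u) (σ : Type v) : Type max u v
  /-- Weighted-sum gate `∑ᵢ cᵢ • uᵢ` (empty sum `= 0`). -/
  | sum (args : List (k × Operand k σ)) : Gate k σ
  /-- Product gate `∏ᵢ uᵢ` (empty product `= 1`). -/
  | prod (args : List (Operand k σ)) : Gate k σ
  deriving DecidableEq

end ArithCircuit

/-- A (straight-line) arithmetic circuit over coefficients `k` and variables `σ`: a list of gates
(gate `i` should only reference gates `j < i`, see `ArithCircuit.WellFormed`) and a designated
output operand (Bürgisser 2000, Def. 2.1; Valiant 1979). [cite: Burgisser2000, Def. 2.1] -/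
structure ArithCircuit (k : Type u) (σ : Type v) : Type max u v where
  /-- The gates, in topological order. -/
  gates : List (ArithCircuit.Gate k σ)
  /-- The output operand. -/
  output : ArithCircuit.Operand k σ

namespace ArithCircuit

variable {k : Type u} {σ : Type v} {τ : Type w}

section Semantics

variable [CommSemiring k]

/-- Semantics of an operand given the list `vals` of values of the gates computed so far:
`var i ↦ X i`, `const c ↦ C c`, `gate j ↦ vals[j]`, with the *junk value* `0` when `j` is out of
range (Bürgisser 2000, Def. 2.1). [cite: Burgisser2000, Def. 2.1] -/
def Operand.eval (vals : List (MvPolynomial σ k)) : Operand k σ → MvPolynomial σ k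
  | .var i => X i
  | .const c => C c
  | .gate j => vals.getD j 0

/-- Semantics of a gate given the values of the earlier gates: `sum args ↦ ∑ c • u.eval`,
`prod args ↦ ∏ u.eval` (Bürgisser 2000, Def. 2.1). [cite: Burgisser2000, Def. 2.1] -/
def Gate.eval (vals : List (MvPolynomial σ k)) : Gate k σ → MvPolynomial σ k
  | .sum args => (args.map fun a => a.1 • a.2.eval vals).sum
  | .prod args => (args.map fun u => u.eval vals).prod

/-- The list of values of a list of gates, computed by a left fold: each gate is evaluated against
the values of the gates before it and its value is appended (Bürgisser 2000, Def. 2.1). [cite: Burgisser2000, Def. 2.1] -/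
def gateValues (gs : List (Gate k σ)) : List (MvPolynomial σ k) :=
  gs.foldl (fun vals g => vals ++ [g.eval vals]) []

/-- The polynomial computed by an arithmetic circuit: the value of its output operand against the
values of all its gates (Bürgisser 2000, Def. 2.1). [cite: Burgisser2000, Def. 2.1] -/
def eval (P : ArithCircuit k σ) : MvPolynomial σ k :=
  P.output.eval (gateValues P.gates)

/-- `P.Computes f` means that the circuit `P` computes the polynomial `f`, i.e. `P.eval = f`
(Bürgisser 2000, Def. 2.1). [cite: Burgisser2000, Def. 2.1] -/
def Computes (P : ArithCircuit k σ) (f : MvPolynomial σ k) : Prop :=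
  P.eval = f

end Semantics

section Measures

/-- The size of a circuit: its number of gates (Bürgisser 2000, Def. 2.1). [cite: Burgisser2000, Def. 2.1] -/
def size (P : ArithCircuit k σ) : ℕ :=
  P.gates.length

/-- The list of operands of a gate (forgetting the coefficients of a sum gate)
(Bürgisser 2000, Def. 2.1). [cite: Burgisser2000, Def. 2.1] -/
def Gate.args : Gate k σ → List (Operand k σ)
  | .sum args => args.map Prod.snd
  | .prod args => args

/-- The fan-in of a gate: its number of operands (Bürgisser 2000, Def. 2.1). [cite: Burgisser2000, Def. 2.1] -/
def Gate.fanIn (g : Gate k σ) : ℕ :=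
  g.args.length

/-- A circuit has fan-in two if every gate has at most two operands (Bürgisser's model,
Bürgisser 2000, Def. 2.1). [cite: Burgisser2000, Def. 2.1] -/
def IsFanInTwo (P : ArithCircuit k σ) : Prop :=
  ∀ g ∈ P.gates, g.fanIn ≤ 2

/-- `u.RefsBelow n` means that the operand `u`, if it is a gate reference `gate j`, satisfies
`j < n` (Bürgisser 2000, Def. 2.1: instruction `i` uses only earlier results). [cite: Burgisser2000, Def. 2.1: instruction  i  uses only earl] -/
def Operand.RefsBelow (n : ℕ) : Operand k σ → Prop
  | .gate j => j < n
  | _ => True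

/-- A circuit is well formed if gate number `i` references only gates `j < i` and the output
references only gates `j < size` (Bürgisser 2000, Def. 2.1). Not needed for the (total)
semantics; see `exists_wellFormed_of_computes`. [cite: Burgisser2000, Def. 2.1] -/
def WellFormed (P : ArithCircuit k σ) : Prop :=
  (∀ (i : ℕ) (g : Gate k σ), P.gates[i]? = some g → ∀ u ∈ g.args, u.RefsBelow i) ∧
    P.output.RefsBelow P.size

/-- Truncate the gate references of an operand at `n`: a junk reference `gate j` with `n ≤ j` is
replaced by `const 0` (its junk value), everything else is unchanged. Against a value list of
length `n` this does not change the semantics (`Operand.eval_truncate`); it is the operation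
behind `exists_wellFormed_of_computes` (outline D1; Bürgisser 2000, Def. 2.1). [cite: Burgisser2000, Def. 2.1] -/
def Operand.truncate [Zero k] (n : ℕ) : Operand k σ → Operand k σ
  | .gate j => if j < n then .gate j else .const 0
  | u => u

section SignConstants

variable [Zero k] [One k] [Add k]

/-- `IsSignConstant c` means `c ∈ {0, 1, -1}`, spelled semiring-friendly as
`c = 0 ∨ c = 1 ∨ c + 1 = 0` (constant-free model; Bürgisser 2000 §1.4, Malod 2003). [cite: Burgisser2000, §1.4  Malod 2003] -/
def IsSignConstant (c : k) : Prop :=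
  c = 0 ∨ c = 1 ∨ c + 1 = 0

/-- An operand has sign constants if it is not a constant outside `{0, 1, -1}`
(Bürgisser 2000 §1.4, Malod 2003). [cite: Burgisser2000, §1.4  Malod 2003] -/
def Operand.HasSignConstants : Operand k σ → Prop
  | .const c => IsSignConstant c
  | _ => True

/-- A gate has sign constants if all its operands do and, for a sum gate, all its coefficients lie
in `{0, 1, -1}` (Bürgisser 2000 §1.4, Malod 2003). [cite: Burgisser2000, §1.4  Malod 2003] -/
def Gate.HasSignConstants : Gate k σ → Prop
  | .sum args => ∀ a ∈ args, IsSignConstant a.1 ∧ a.2.HasSignConstants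
  | .prod args => ∀ u ∈ args, u.HasSignConstants

/-- A circuit has sign constants (is *constant-free*) if every constant operand and every sum
coefficient occurring in it lies in `{0, 1, -1}` (Bürgisser 2000 §1.4, Malod 2003). This is the
model in which a circuit over `ℤ` has a finite description of length proportional to its size. [cite: Burgisser2000, §1.4  Malod 2003] -/
def HasSignConstants (P : ArithCircuit k σ) : Prop :=
  (∀ g ∈ P.gates, g.HasSignConstants) ∧ P.output.HasSignConstants

end SignConstants

end Measures

section Constructions

/-- The gate-free circuit whose output is the variable `X i` (Bürgisser 2000, Def. 2.1: inputs
are free). [cite: Burgisser2000, Def. 2.1: inputs are free] -/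
def ofVar (i : σ) : ArithCircuit k σ where
  gates := []
  output := .var i

/-- The gate-free circuit whose output is the constant `c` (Bürgisser 2000, Def. 2.1: constants
of `k` are free). [cite: Burgisser2000, Def. 2.1: constants of  k  are free] -/
def ofConst (c : k) : ArithCircuit k σ where
  gates := []
  output := .const c

variable {k' : Type u'}

/-- Apply a map `φ : k → k'` to the constant of an operand (used with a ring hom in
`ArithCircuit.map`; Bürgisser 2000, §4.1, extension of scalars). [cite: Burgisser2000, §4.1  extension of scalars] -/
def Operand.map (φ : k → k') : Operand k σ → Operand k' σ
  | .var i => .var i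
  | .const c => .const (φ c)
  | .gate j => .gate j

/-- Apply a map `φ : k → k'` to all constants and coefficients of a gate
(Bürgisser 2000, §4.1). [cite: Burgisser2000, §4.1] -/
def Gate.map (φ : k → k') : Gate k σ → Gate k' σ
  | .sum args => .sum (args.map fun a => (φ a.1, a.2.map φ))
  | .prod args => .prod (args.map (Operand.map φ))

/-- Change of coefficients along a ring homomorphism `φ : k →+* k'`: apply `φ` to every constant
and every sum coefficient. The resulting circuit computes `MvPolynomial.map φ P.eval`
(Bürgisser 2000, §4.1). [cite: Burgisser2000, §4.1] -/
def map [CommSemiring k] [CommSemiring k'] (φ : k →+* k') (P : ArithCircuit k σ) :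
    ArithCircuit k' σ where
  gates := P.gates.map (Gate.map φ)
  output := P.output.map φ

/-- Rename the variables of an operand along `e : σ → τ` (cf. `MvPolynomial.rename`). [folklore] -/
def Operand.rename (e : σ → τ) : Operand k σ → Operand k τ
  | .var i => .var (e i)
  | .const c => .const c
  | .gate j => .gate j

/-- Rename the variables of a gate along `e : σ → τ` (cf. `MvPolynomial.rename`). [folklore] -/
def Gate.rename (e : σ → τ) : Gate k σ → Gate k τ
  | .sum args => .sum (args.map fun a => (a.1, a.2.rename e))
  | .prod args => .prod (args.map (Operand.rename e))

/-- Rename the variables of a circuit along `e : σ → τ`; it computes `MvPolynomial.rename e P.eval`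
(`eval_rename`) and has the same size (Bürgisser 2000, Def. 2.1 and Rem. 2.2). [cite: Burgisser2000, Def. 2.1 and Rem. 2.2] -/
def rename (e : σ → τ) (P : ArithCircuit k σ) : ArithCircuit k τ where
  gates := P.gates.map (Gate.rename e)
  output := P.output.rename e

/-- Shift every gate reference of an operand by `n`: `gate j ↦ gate (j + n)` (index bookkeeping
for `ArithCircuit.append`). [folklore] -/
def Operand.shift (n : ℕ) : Operand k σ → Operand k σ
  | .var i => .var i
  | .const c => .const c
  | .gate j => .gate (j + n)

/-- Shift every gate reference of a gate by `n` (index bookkeeping for `ArithCircuit.append`). [folklore] -/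
def Gate.shift (n : ℕ) : Gate k σ → Gate k σ
  | .sum args => .sum (args.map fun a => (a.1, a.2.shift n))
  | .prod args => .prod (args.map (Operand.shift n))

/-- Sequential composition of circuits: the gates of `P` followed by the gates of `Q` with all gate
references shifted by `P.size`; the output is `Q`'s (shifted) output, while `P`'s value remains
available as the operand `P.output.truncate P.size` (plain `P.output` only if
`P.output.RefsBelow P.size`, since an unshifted junk reference of `P` would now read one of `Q`'s
gates). Size is additive (Bürgisser 2000, proof of Prop. 2.3). [cite: Burgisser2000, proof of Prop. 2.3] -/
def append (P Q : ArithCircuit k σ) : ArithCircuit k σ where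
  gates := P.gates ++ Q.gates.map (Gate.shift P.size)
  output := Q.output.shift P.size

/-- The circuit computing `P.eval + Q.eval`: `append P Q` followed by one sum gate
`1 • (P.output.truncate P.size) + 1 • (Q.output.shift P.size)`; the truncation makes `eval_add`
hold also for non-well-formed `P` (Bürgisser 2000, Def. 2.1). [cite: Burgisser2000, Def. 2.1] -/
def add [CommSemiring k] (P Q : ArithCircuit k σ) : ArithCircuit k σ where
  gates := (P.append Q).gates ++
    [.sum [(1, P.output.truncate P.size), (1, Q.output.shift P.size)]]
  output := .gate (P.size + Q.size)

/-- The circuit computing `P.eval * Q.eval`: `append P Q` followed by one product gate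
`(P.output.truncate P.size) * (Q.output.shift P.size)`; the truncation makes `eval_mul` hold also
for non-well-formed `P` (Bürgisser 2000, Def. 2.1). [cite: Burgisser2000, Def. 2.1] -/
def mul [Zero k] (P Q : ArithCircuit k σ) : ArithCircuit k σ where
  gates := (P.append Q).gates ++ [.prod [P.output.truncate P.size, Q.output.shift P.size]]
  output := .gate (P.size + Q.size)

/-- The circuit computing `c • P.eval`: `P` followed by one sum gate `c • P.output`
(Bürgisser 2000, Def. 2.1). [cite: Burgisser2000, Def. 2.1] -/
def smul (c : k) (P : ArithCircuit k σ) : ArithCircuit k σ where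
  gates := P.gates ++ [.sum [(c, P.output)]]
  output := .gate P.size

end Constructions

end ArithCircuit

section Complexity

variable {k : Type u} {σ : Type v} {τ : Type w} [CommSemiring k]

/-- The (fan-in-two) circuit complexity of a polynomial `f`: the least size of a fan-in-two
arithmetic circuit computing `f`. This is Bürgisser's total complexity `L_k(f)` (Bürgisser 2000,
Def. 2.1) up to a constant factor `≤ 3` (a weighted sum gate `c • u + d • v` counts one here and
up to three there). The defining set is nonempty by `ArithCircuit.exists_computes`; formally the
junk value `sInf ∅ = 0` would apply otherwise. [cite: Burgisser2000, Def. 2.1] -/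
def complexity (f : MvPolynomial σ k) : ℕ :=
  sInf {s | ∃ P : ArithCircuit k σ, P.IsFanInTwo ∧ P.Computes f ∧ P.size = s}

/-- The constant-free circuit complexity of `f`: the least size of a fan-in-two circuit with all
constants and sum coefficients in `{0, 1, -1}` computing `f` (Bürgisser 2000 §1.4; Malod 2003,
"calculs sans constantes"). Junk value `0` (`sInf ∅`) when no such circuit exists, e.g. for
`f = C (1/2)` over `ℚ`; over `ℤ` the set is nonempty by
`ArithCircuit.exists_computes_hasSignConstants`. [cite: Burgisser2000, §1.4] -/
def constantFreeComplexity (f : MvPolynomial σ k) : ℕ :=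
  sInf {s | ∃ P : ArithCircuit k σ, P.IsFanInTwo ∧ P.HasSignConstants ∧ P.Computes f ∧ P.size = s}

/-- The unbounded fan-in circuit size of `f`: the least number of gates of an arithmetic circuit
(no fan-in restriction) computing `f` (the size measure of constant-depth circuit lower bounds,
Limaye–Srinivasan–Tavenas 2021 §1). Nonempty defining set by `ArithCircuit.exists_computes`;
junk `sInf ∅ = 0` otherwise. [cite: LimayeSrinivasanTavenas2021, §1] -/
def circuitSize (f : MvPolynomial σ k) : ℕ :=
  sInf {s | ∃ P : ArithCircuit k σ, P.Computes f ∧ P.size = s}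

end Complexity

/-! ### API lemmas -/

namespace ArithCircuit

variable {k : Type u} {σ : Type v} {τ : Type w}

/-- Input variables cost no gates (Bürgisser 2000, Def. 2.1). [cite: Burgisser2000, Def. 2.1] -/
@[simp]
theorem size_ofVar (i : σ) : (ofVar i : ArithCircuit k σ).size = 0 := rfl

/-- Constants cost no gates (Bürgisser 2000, Def. 2.1). [cite: Burgisser2000, Def. 2.1] -/
@[simp]
theorem size_ofConst (c : k) : (ofConst c : ArithCircuit k σ).size = 0 := rfl

/-- Sequential composition is additive in size (Bürgisser 2000, proof of Prop. 2.3). [cite: Burgisser2000, proof of Prop. 2.3] -/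
@[simp]
theorem size_append (P Q : ArithCircuit k σ) : (P.append Q).size = P.size + Q.size := by
  simp [append, size]

/-- Renaming preserves size (Bürgisser 2000, Rem. 2.2). [cite: Burgisser2000, Rem. 2.2] -/
@[simp]
theorem size_rename (e : σ → τ) (P : ArithCircuit k σ) : (P.rename e).size = P.size := by
  simp [rename, size]

variable [CommSemiring k]

/-- The circuit `ofVar i` computes `X i` (Bürgisser 2000, Def. 2.1). [cite: Burgisser2000, Def. 2.1] -/
@[simp]
theorem eval_ofVar (i : σ) : (ofVar i : ArithCircuit k σ).eval = X i := rfl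

/-- The circuit `ofConst c` computes `C c` (Bürgisser 2000, Def. 2.1). [cite: Burgisser2000, Def. 2.1] -/
@[simp]
theorem eval_ofConst (c : k) : (ofConst c : ArithCircuit k σ).eval = C c := rfl

/-- One step of the left fold defining `gateValues` (Bürgisser 2000, Def. 2.1). [cite: Burgisser2000, Def. 2.1] -/
@[simp]
theorem gateValues_append_singleton (gs : List (Gate k σ)) (g : Gate k σ) :
    gateValues (gs ++ [g]) = gateValues gs ++ [g.eval (gateValues gs)] := by
  simp [gateValues, List.foldl_append]

/-- The value list of a gate list has one entry per gate (Bürgisser 2000, Def. 2.1). [cite: Burgisser2000, Def. 2.1] -/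
@[simp]
theorem gateValues_length (gs : List (Gate k σ)) : (gateValues gs).length = gs.length := by
  induction gs using List.reverseRecOn with
  | nil => rfl
  | append_singleton gs g ih => simp [gateValues_append_singleton, ih]

/-- Truncating at the length of the value list does not change the value of an operand: junk
references evaluate to `0 = C 0` either way (outline D1; Bürgisser 2000, Def. 2.1). [cite: Burgisser2000, Def. 2.1] -/
theorem Operand.eval_truncate (vals : List (MvPolynomial σ k)) (u : Operand k σ) :
    (u.truncate vals.length).eval vals = u.eval vals := by
  cases u with
  | var i => rfl
  | const c => rfl
  | gate j =>
    by_cases h : j < vals.length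
    · simp [Operand.truncate, h]
    · simp [Operand.truncate, Operand.eval, h, List.getD_eq_getElem?_getD]

/-- Unfolding lemma: a gate reference reads the value list, junk `0` out of range
(Bürgisser 2000, Def. 2.1). [cite: Burgisser2000, Def. 2.1] -/
@[simp]
theorem Operand.eval_gate (vals : List (MvPolynomial σ k)) (j : ℕ) :
    (Operand.gate j : Operand k σ).eval vals = vals.getD j 0 := rfl

/-- A truncated operand ignores any values appended after the truncation point
(index bookkeeping for `append`; Bürgisser 2000, proof of Prop. 2.3). [cite: Burgisser2000, proof of Prop. 2.3] -/
theorem Operand.eval_truncate_append (vals ws : List (MvPolynomial σ k)) (u : Operand k σ) :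
    (u.truncate vals.length).eval (vals ++ ws) = u.eval vals := by
  cases u with
  | var i => rfl
  | const c => rfl
  | gate j =>
    by_cases h : j < vals.length
    · simp [Operand.truncate, Operand.eval, h, List.getD_eq_getElem?_getD,
        List.getElem?_append_left h]
    · simp [Operand.truncate, Operand.eval, h, List.getD_eq_getElem?_getD]

/-- A shifted operand reads the values appended after the shift point
(index bookkeeping for `append`; Bürgisser 2000, proof of Prop. 2.3). [cite: Burgisser2000, proof of Prop. 2.3] -/
theorem Operand.eval_shift_append (vals ws : List (MvPolynomial σ k)) (u : Operand k σ) :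
    (u.shift vals.length).eval (vals ++ ws) = u.eval ws := by
  cases u with
  | var i => rfl
  | const c => rfl
  | gate j =>
    simp [Operand.shift, Operand.eval, List.getD_eq_getElem?_getD,
      List.getElem?_append_right (Nat.le_add_left vals.length j)]

/-- The value list of a sequential composition is the concatenation of the value lists
(Bürgisser 2000, proof of Prop. 2.3). [cite: Burgisser2000, proof of Prop. 2.3] -/
def gateValues_append : Prop :=
  ∀ (P Q : ArithCircuit k σ),
    gateValues (P.append Q).gates = gateValues P.gates ++ gateValues Q.gates

/-- Renaming a circuit renames the computed polynomial (Bürgisser 2000, Rem. 2.2). [cite: Burgisser2000, Rem. 2.2] -/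
def eval_rename : Prop :=
  ∀ (e : σ → τ) (P : ArithCircuit k σ),
    (P.rename e).eval = MvPolynomial.rename e P.eval

/-- Change of coefficients along a ring hom maps the computed polynomial (Bürgisser 2000, §4.1). [cite: Burgisser2000, §4.1] -/
def eval_map : Prop :=
  ∀ {k' : Type w} [CommSemiring k'] (φ : k →+* k') (P : ArithCircuit k σ),
    (P.map φ).eval = MvPolynomial.map φ P.eval

/-- The sum construction computes the sum, for arbitrary (not necessarily well-formed) `P`, `Q`
(Bürgisser 2000, Def. 2.1 / §2.1). [cite: Burgisser2000, Def. 2.1 / §2.1] -/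
def eval_add : Prop :=
  ∀ (P Q : ArithCircuit k σ),
    (P.add Q).eval = P.eval + Q.eval

/- interim proof relied on results that are now named facts (D-0014); demoted to a fact by the M5 import, proof preserved:
:= by
  have hP := gateValues_length (k := k) P.gates
  have hQ := gateValues_length (k := k) Q.gates
  have h1 := Operand.eval_truncate_append (gateValues P.gates) (gateValues Q.gates) P.output
  have h2 := Operand.eval_shift_append (gateValues P.gates) (gateValues Q.gates) Q.output
  rw [hP] at h1 h2
  simp [eval, add, gateValues_append, Gate.eval, size, List.getD_eq_getElem?_getD, hP, hQ,
    h1, h2]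
-/

/-- The product construction computes the product, for arbitrary (not necessarily well-formed)
`P`, `Q` (Bürgisser 2000, Def. 2.1 / §2.1). [cite: Burgisser2000, Def. 2.1 / §2.1] -/
def eval_mul : Prop :=
  ∀ (P Q : ArithCircuit k σ),
    (P.mul Q).eval = P.eval * Q.eval

/- interim proof relied on results that are now named facts (D-0014); demoted to a fact by the M5 import, proof preserved:
:= by
  have hP := gateValues_length (k := k) P.gates
  have hQ := gateValues_length (k := k) Q.gates
  have h1 := Operand.eval_truncate_append (gateValues P.gates) (gateValues Q.gates) P.output
  have h2 := Operand.eval_shift_append (gateValues P.gates) (gateValues Q.gates) Q.output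
  rw [hP] at h1 h2
  simp [eval, mul, gateValues_append, Gate.eval, size, List.getD_eq_getElem?_getD, hP, hQ,
    h1, h2]
-/

/-- The scalar-multiple construction computes the scalar multiple
(Bürgisser 2000, Def. 2.1 / §2.1). [cite: Burgisser2000, Def. 2.1 / §2.1] -/
theorem eval_smul (c : k) (P : ArithCircuit k σ) : (P.smul c).eval = c • P.eval := by
  have h := gateValues_length (k := k) P.gates
  simp [eval, smul, gateValues_append_singleton, Operand.eval, Gate.eval, size,
    List.getD_eq_getElem?_getD, h]

/-- Every polynomial is computed by some well-formed fan-in-two circuit (write `f` as a sum of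
monomials; Bürgisser 2000, §2.1). In particular the set defining `complexity f` is nonempty. [cite: Burgisser2000, §2.1] -/
def exists_computes : Prop :=
  ∀ (f : MvPolynomial σ k),
    ∃ P : ArithCircuit k σ, P.IsFanInTwo ∧ P.WellFormed ∧ P.Computes f

/-- Every integer polynomial is computed by some fan-in-two constant-free circuit (integer
coefficients are iterated sums of `±1`; Bürgisser 2000 §1.4, Malod 2003). In particular the set
defining `constantFreeComplexity f` is nonempty over `ℤ`. [cite: Burgisser2000, §1.4  Malod 2003] -/
def exists_computes_hasSignConstants : Prop :=
  ∀ (f : MvPolynomial σ ℤ),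
    ∃ P : ArithCircuit ℤ σ, P.IsFanInTwo ∧ P.HasSignConstants ∧ P.Computes f

/-- Junk (forward or out-of-range) gate references never help: any circuit computing `f` can be
replaced by a well-formed one of the same size computing `f` (replace each junk reference by
`const 0`), preserving fan-in two and sign constants (design note D1 of the outline;
Bürgisser 2000, Def. 2.1). [cite: Burgisser2000, Def. 2.1] -/
def exists_wellFormed_of_computes : Prop :=
  ∀ {P : ArithCircuit k σ} {f : MvPolynomial σ k} (h : P.Computes f),
    ∃ Q : ArithCircuit k σ, Q.WellFormed ∧ Q.Computes f ∧ Q.size = P.size ∧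
      (P.IsFanInTwo → Q.IsFanInTwo) ∧ (P.HasSignConstants → Q.HasSignConstants)

end ArithCircuit

section ComplexityLemmas

variable {k : Type u} {σ : Type v} {τ : Type w} [CommSemiring k]

/-- Variables are free: `L(X i) = 0` (Bürgisser 2000, Def. 2.1). [cite: Burgisser2000, Def. 2.1] -/
def complexity_X : Prop :=
  ∀ (i : σ),
    complexity (X i : MvPolynomial σ k) = 0

/-- Constants are free: `L(C c) = 0` (Bürgisser 2000, Def. 2.1). [cite: Burgisser2000, Def. 2.1] -/
def complexity_C : Prop :=
  ∀ (c : k),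
    complexity (C c : MvPolynomial σ k) = 0

/-- Subadditivity: `L(f + g) ≤ L(f) + L(g) + 1` (Bürgisser 2000, §2.1). [cite: Burgisser2000, §2.1] -/
def complexity_add_le : Prop :=
  ∀ (f g : MvPolynomial σ k),
    complexity (f + g) ≤ complexity f + complexity g + 1

/-- Submultiplicativity: `L(f * g) ≤ L(f) + L(g) + 1` (Bürgisser 2000, §2.1). [cite: Burgisser2000, §2.1] -/
def complexity_mul_le : Prop :=
  ∀ (f g : MvPolynomial σ k),
    complexity (f * g) ≤ complexity f + complexity g + 1

/-- Scalar multiples cost at most one gate: `L(c • f) ≤ L(f) + 1` (Bürgisser 2000, §2.1). [cite: Burgisser2000, §2.1] -/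
def complexity_smul_le : Prop :=
  ∀ (c : k) (f : MvPolynomial σ k),
    complexity (c • f) ≤ complexity f + 1

/-- Renaming variables does not increase complexity (rename the circuit; Bürgisser 2000,
Rem. 2.2). No injectivity is needed for this inequality. [cite: Burgisser2000, Rem. 2.2] -/
def complexity_rename_le : Prop :=
  ∀ (e : σ → τ) (f : MvPolynomial σ k),
    complexity (MvPolynomial.rename e f) ≤ complexity f

/-- Renaming along an injective map preserves complexity (rename back along a left inverse;
Bürgisser 2000, Rem. 2.2). [cite: Burgisser2000, Rem. 2.2] -/
def complexity_rename_of_injective : Prop :=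
  ∀ {e : σ → τ} (he : Function.Injective e) (f : MvPolynomial σ k),
    complexity (MvPolynomial.rename e f) = complexity f

/-- Complexity is invariant under renaming along an equivalence of variable types
(Bürgisser 2000, Rem. 2.2). Not a `simp` lemma: `renameEquiv_apply` rewrites the left-hand side to
`complexity (rename e f)`, which is handled by `complexity_rename_of_injective`. [cite: Burgisser2000, Rem. 2.2] -/
def complexity_renameEquiv : Prop :=
  ∀ (e : σ ≃ τ) (f : MvPolynomial σ k),
    complexity (MvPolynomial.renameEquiv k e f) = complexity f

/-- The constant-free complexity dominates the complexity whenever some constant-free circuit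
computes `f` (otherwise `constantFreeComplexity f` is the junk value `0`; Bürgisser 2000 §1.4). [cite: Burgisser2000, §1.4] -/
def complexity_le_constantFreeComplexity : Prop :=
  ∀ {f : MvPolynomial σ k} (h : ∃ P : ArithCircuit k σ, P.IsFanInTwo ∧ P.HasSignConstants ∧ P.Computes f),
    complexity f ≤ constantFreeComplexity f

/-- Subadditivity and submultiplicativity go through `ArithCircuit.add` / `ArithCircuit.mul`
(`eval_add`, `eval_mul`, `size_append`); no well-formedness reduction is needed thanks to
`Operand.truncate`. Dropping the fan-in restriction can only decrease the minimal size
(Bürgisser 2000, Def. 2.1 / §2.1; attainment of `complexity f` by `exists_computes`). [cite: Burgisser2000, Def. 2.1 / §2.1] -/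
def circuitSize_le_complexity : Prop :=
  ∀ (f : MvPolynomial σ k),
    circuitSize f ≤ complexity f

end ComplexityLemmas

/-! ### Discharges: renaming circuits (Bürgisser 2000, Rem. 2.2) and free inputs

Proofs of the named facts `ArithCircuit.eval_rename`, `complexity_renameEquiv`, `complexity_X`,
`complexity_C` from the definitions above. The renaming argument is the one-line remark in
Bürgisser 2000, Rem. 2.2 (the complexity of `f` does not depend on the naming of the variables:
rename every input of a straight-line program); here it is carried out gate by gate on the total
fold semantics. Because `ArithCircuit.exists_computes` is still a named fact, the general inequality
`L(rename e f) ≤ L(f)` is proved under the hypothesis that some fan-in-two circuit computes `f`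
(`complexity_rename_le_of_exists`); for an *equivalence* `e` this hypothesis transfers in both
directions, so `complexity_renameEquiv_holds` is unconditional. The gate-level helper lemmas
(`Gate.fanIn_rename`, `Operand.eval_rename`, `Gate.eval_rename`, `gateValues_rename`) are
`private`: their natural names are already declared, with the same statements, in
`Summits/ValiantsHypothesis/ValiantsHypothesis/Theorems/StatementJunkGuardArithCircuitExistsComputesProved.lean`,
which imports this file. -/

namespace ArithCircuit

variable {k : Type u} {σ : Type v} {τ : Type w}

/-- Renaming the variables of a gate does not change its fan-in (Bürgisser 2000, Rem. 2.2). [cite: Burgisser2000, Rem. 2.2] -/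
private theorem Gate.fanIn_rename (e : σ → τ) (g : Gate k σ) : (g.rename e).fanIn = g.fanIn := by
  cases g <;> simp [Gate.rename, Gate.fanIn, Gate.args]

/-- Renaming the variables of a circuit preserves fan-in two (Bürgisser 2000, Rem. 2.2). [cite: Burgisser2000, Rem. 2.2] -/
theorem IsFanInTwo.rename {P : ArithCircuit k σ} (h : P.IsFanInTwo) (e : σ → τ) :
    (P.rename e).IsFanInTwo := by
  intro g hg
  simp only [ArithCircuit.rename, List.mem_map] at hg
  obtain ⟨g', hg', rfl⟩ := hg
  rw [Literature.Computability.AlgebraicComplexity.ArithCircuit.Gate.fanIn_rename]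
  exact h g' hg'

variable [CommSemiring k]

/-- A renamed operand, read against the renamed value list, evaluates to the renamed value
(Bürgisser 2000, Rem. 2.2; the junk value `0` is fixed by `rename e`). [cite: Burgisser2000, Rem. 2.2] -/
private theorem Operand.eval_rename (e : σ → τ) (vals : List (MvPolynomial σ k)) (u : Operand k σ) :
    (u.rename e).eval (vals.map (MvPolynomial.rename e)) =
      MvPolynomial.rename e (u.eval vals) := by
  cases u with
  | var i => simp [Operand.rename, Operand.eval]
  | const c => simp [Operand.rename, Operand.eval]
  | gate j =>
    simp only [Operand.rename, Operand.eval, List.getD_eq_getElem?_getD, List.getElem?_map]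
    cases vals[j]? <;> simp

/-- A renamed gate, read against the renamed value list, evaluates to the renamed value: `rename e`
is an algebra map, so it commutes with weighted sums and products (Bürgisser 2000, Rem. 2.2). [cite: Burgisser2000, Rem. 2.2] -/
private theorem Gate.eval_rename (e : σ → τ) (vals : List (MvPolynomial σ k)) (g : Gate k σ) :
    (g.rename e).eval (vals.map (MvPolynomial.rename e)) =
      MvPolynomial.rename e (g.eval vals) := by
  cases g with
  | sum args =>
    simp only [Gate.rename, Gate.eval, List.map_map, map_list_sum]
    congr 1
    simp [Function.comp_def, Literature.Computability.AlgebraicComplexity.ArithCircuit.Operand.eval_rename]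
  | prod args =>
    simp only [Gate.rename, Gate.eval, List.map_map, map_list_prod]
    congr 1
    simp [Function.comp_def, Literature.Computability.AlgebraicComplexity.ArithCircuit.Operand.eval_rename]

/-- The value list of a renamed gate list is the renamed value list (induction along the fold;
Bürgisser 2000, Rem. 2.2). [cite: Burgisser2000, Rem. 2.2] -/
private theorem gateValues_rename (e : σ → τ) (gs : List (Gate k σ)) :
    gateValues (gs.map (Gate.rename e)) = (gateValues gs).map (MvPolynomial.rename e) := by
  induction gs using List.reverseRecOn with
  | nil => rfl
  | append_singleton gs g ih =>
    rw [List.map_append, List.map_singleton, gateValues_append_singleton,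
      gateValues_append_singleton, ih, Literature.Computability.AlgebraicComplexity.ArithCircuit.Gate.eval_rename, List.map_append, List.map_singleton]

/-- Renaming a circuit renames the computed polynomial, pointwise form
(Bürgisser 2000, Rem. 2.2). [cite: Burgisser2000, Rem. 2.2] -/
theorem eval_rename_apply (e : σ → τ) (P : ArithCircuit k σ) :
    (P.rename e).eval = MvPolynomial.rename e P.eval := by
  change (P.output.rename e).eval (gateValues (P.gates.map (Gate.rename e))) = _
  rw [gateValues_rename, Literature.Computability.AlgebraicComplexity.ArithCircuit.Operand.eval_rename]
  rfl

/-- Discharge of the named fact `ArithCircuit.eval_rename`: renaming a circuit renames the computed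
polynomial (Bürgisser 2000, Rem. 2.2). Primed because the unprimed name
`ArithCircuit.eval_rename_holds` is occupied (pointwise form) by
`Summits/ValiantsHypothesis/ValiantsHypothesis/Theorems/StatementJunkGuardArithCircuitExistsComputesProved.lean`,
which cannot be imported here. [cite: Burgisser2000, Rem. 2.2] -/
theorem eval_rename_holds' : eval_rename (k := k) (σ := σ) (τ := τ) :=
  eval_rename_apply

/-- If `P` computes `f` then `P.rename e` computes `rename e f` (Bürgisser 2000, Rem. 2.2). [cite: Burgisser2000, Rem. 2.2] -/
theorem Computes.rename {P : ArithCircuit k σ} {f : MvPolynomial σ k} (h : P.Computes f)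
    (e : σ → τ) : (P.rename e).Computes (MvPolynomial.rename e f) := by
  unfold Computes at h ⊢
  rw [eval_rename_apply, h]

end ArithCircuit

section RenameDischarges

variable {k : Type u} {σ : Type v} {τ : Type w} [CommSemiring k]

/-- `L(rename e f) ≤ L(f)` as soon as some fan-in-two circuit computes `f` (rename a minimal
circuit; Bürgisser 2000, Rem. 2.2). The existence hypothesis is always satisfied
(`ArithCircuit.exists_computes`, a named fact); it is kept explicit so that this lemma is proved
outright. [cite: Burgisser2000, Rem. 2.2] -/
theorem complexity_rename_le_of_exists (e : σ → τ) {f : MvPolynomial σ k}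
    (hf : ∃ P : ArithCircuit k σ, P.IsFanInTwo ∧ P.Computes f) :
    complexity (MvPolynomial.rename e f) ≤ complexity f := by
  obtain ⟨P₀, hP₀, hP₀f⟩ := hf
  have hne : {s | ∃ P : ArithCircuit k σ, P.IsFanInTwo ∧ P.Computes f ∧ P.size = s}.Nonempty :=
    ⟨P₀.size, P₀, hP₀, hP₀f, rfl⟩
  obtain ⟨P, hP, hPf, hPs⟩ := Nat.sInf_mem hne
  refine Nat.sInf_le ⟨P.rename e, hP.rename e, hPf.rename e, ?_⟩
  rw [ArithCircuit.size_rename, hPs]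
  rfl

/-- The documented junk case of `complexity`: if no fan-in-two circuit computes `f`, the defining
set is empty and `complexity f = sInf ∅ = 0` (Bürgisser 2000, Def. 2.1; never happens by
`ArithCircuit.exists_computes`). [cite: Burgisser2000, Def. 2.1] -/
theorem complexity_eq_zero_of_not_exists {f : MvPolynomial σ k}
    (hf : ¬ ∃ P : ArithCircuit k σ, P.IsFanInTwo ∧ P.Computes f) : complexity f = 0 := by
  apply Nat.sInf_eq_zero.mpr (Or.inr ?_)
  ext s
  simp only [Set.mem_setOf_eq, Set.mem_empty_iff_false, iff_false, not_exists, not_and]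
  intro P hP hPf _
  exact hf ⟨P, hP, hPf⟩

/-- Discharge of `complexity_renameEquiv`: `L(renameEquiv e f) = L(f)` for an equivalence `e` of
variable types — rename a circuit along `e`, and back along `e.symm` (Bürgisser 2000, Rem. 2.2). [cite: Burgisser2000, Rem. 2.2] -/
theorem complexity_renameEquiv_holds : complexity_renameEquiv (k := k) (σ := σ) (τ := τ) := by
  intro e f
  rw [MvPolynomial.renameEquiv_apply]
  by_cases hf : ∃ P : ArithCircuit k σ, P.IsFanInTwo ∧ P.Computes f
  · refine le_antisymm (complexity_rename_le_of_exists e hf) ?_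
    obtain ⟨P, hP, hPf⟩ := hf
    have h := complexity_rename_le_of_exists e.symm ⟨P.rename e, hP.rename e, hPf.rename e⟩
    rwa [MvPolynomial.rename_rename, e.symm_comp_self, MvPolynomial.rename_id_apply] at h
  · have hf' : ¬ ∃ P : ArithCircuit k τ, P.IsFanInTwo ∧ P.Computes (MvPolynomial.rename e f) := by
      rintro ⟨P, hP, hPf⟩
      refine hf ⟨P.rename e.symm, hP.rename e.symm, ?_⟩
      have h := hPf.rename e.symm
      rwa [MvPolynomial.rename_rename, e.symm_comp_self, MvPolynomial.rename_id_apply] at h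
    rw [complexity_eq_zero_of_not_exists hf, complexity_eq_zero_of_not_exists hf']

/-- Discharge of `complexity_X`: the gate-free circuit `ofVar i` computes `X i`, so `L(X i) = 0`
(Bürgisser 2000, Def. 2.1: inputs are free). [cite: Burgisser2000, Def. 2.1] -/
theorem complexity_X_holds : complexity_X (k := k) (σ := σ) := by
  intro i
  apply Nat.eq_zero_of_le_zero
  exact Nat.sInf_le ⟨ArithCircuit.ofVar i, fun g hg => by simp [ArithCircuit.ofVar] at hg, rfl,
    rfl⟩

/-- Discharge of `complexity_C`: the gate-free circuit `ofConst c` computes `C c`, so `L(C c) = 0`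
(Bürgisser 2000, Def. 2.1: constants of `k` are free). [cite: Burgisser2000, Def. 2.1] -/
theorem complexity_C_holds : complexity_C (k := k) (σ := σ) := by
  intro c
  apply Nat.eq_zero_of_le_zero
  exact Nat.sInf_le ⟨ArithCircuit.ofConst c, fun g hg => by simp [ArithCircuit.ofConst] at hg,
    rfl, rfl⟩

end RenameDischarges

end Literature.Computability.AlgebraicComplexity
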